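import Mathlib
import HarnessLib
import Literature.Algebra.Polynomial.ChebyshevBertram

/-!
# Chains of permutable polynomials: every chain is similar to `{x^j}` or `{T_j}` (Rivlin, Sect. 4.1, Theorem 4.4)

Source: T. J. Rivlin, *The Chebyshev Polynomials*, Wiley 1974, Chapter 4 "Iterative Properties and
Some Remarks About the Graphs of the T_n", Sect. 4.1 (Theorem 4.4 and its proof, equations (4.3), (4.5), (4.8), (4.9); pp. 98-101 of the
held scan `book:rivlinnd-chebyshev-polynomials`); original sources H. D. Block and H. P. Thielman,
"Commutative polynomials", Quart. J. Math. Oxford Ser. (2) 2 (1951) 241-243, and E. Jacobsthal,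
"Über vertauschbare Polynome", Math. Z. 63 (1955) 243-276.  Bib key `Rivlin1974`.

A *chain* (`IsPermutableChain`, from `Literature.Algebra.Polynomial.ChebyshevBertram`) is a sequence
`p_1, p_2, …` of polynomials, `deg p_j = j`, any two of which commute under composition.  Rivlin's
Theorems 4.1-4.3 (the chain through `T_2` is `{T_j}`, the chain through `x²` is `{x^j}`, similar
polynomials commute alike) are in `ChebyshevBertram`; this file completes Sect. 4.1 with

* `cubic_comm_X_sq_add_C` — the computational heart of Theorem 4.4: a cubic commuting with
  `x² + c` forces `c ∈ {0, -2}` and is `x³ + (3c/2) x` ((4.8)-(4.9): parity, then equating the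
  coefficients of `x⁶, x⁴, x²`);
* `isPermutableChain_chebyshevC`, `natDegree_chebyshevC` — the third normal form `{C_j}`
  (`x, x² − 2, x³ − 3x, …`, Mathlib's `Polynomial.Chebyshev.C`, composing by `Chebyshev.C_mul`),
  and `isPermutableChain_apply_eq_chebyshevC` — a chain through `x² − 2` is `{C_j}`;
* `isPermutableChain_similar` — similarity (4.3) carries chains to chains;
* `isPermutableChain_similar_X_pow_or_T` — THEOREM 4.4: every chain over a field of characteristic
  zero is similar (by an explicit pair of mutually inverse degree-one polynomials) to `{x^j}` or to
  `{T_j}`.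

Conventions: similarity `λ⁻¹ · p · λ` is written `μ ∘ p ∘ λ = mu.comp (p.comp lam)` with
`lam.comp mu = X` (and `mu.comp lam = X`), as in `ChebyshevBertram`; `Polynomial.C` is always written
qualified (the Chebyshev namespace is open, whose `C` is the Dickson-type polynomial `Chebyshev.C`).
No instances, notation or attributes are introduced.
-/

open Polynomial
open Polynomial.Chebyshev

namespace Literature.Algebra.Polynomial.ChebyshevChains

section Parity

variable {R : Type*} [CommRing R]

/-- Coefficients of `p(−x)`: `[x^k] p(−x) = (−1)^k [x^k] p(x)` (restated privately; the same
statement is `Literature.AlgebraicGeometry.Deligne1982.WeilTypeCMOfCMField.coeff_comp_neg_X`, not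
imported here to keep this file's imports inside `Algebra/Polynomial`). [folklore] -/
private theorem coeff_comp_negX (p : R[X]) (k : ℕ) :
    (p.comp (-X)).coeff k = (-1) ^ k * p.coeff k := by
  induction p using Polynomial.induction_on' with
  | add p q hp hq => simp only [add_comp, coeff_add, hp, hq, mul_add]
  | monomial n a =>
      rw [← C_mul_X_pow_eq_monomial, mul_comp, C_comp, X_pow_comp, neg_pow,
        show (-1 : R[X]) ^ n = Polynomial.C ((-1 : R) ^ n) by simp, ← mul_assoc, ← map_mul,
        coeff_C_mul_X_pow, coeff_C_mul_X_pow]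
      split_ifs with h
      · subst h; ring
      · simp

/-- An odd polynomial (`p(−x) = −p(x)`) over a ring with `2` a non-zero-divisor has vanishing even
coefficients. [cite: Rivlin1974, Sect. 4.1 Thm. 4.4 (proof, (4.9))] -/
theorem coeff_eq_zero_of_comp_neg_X_eq_neg [NoZeroDivisors R] (h2 : (2 : R) ≠ 0) {p : R[X]}
    (hp : p.comp (-X) = -p) {k : ℕ} (hk : Even k) : p.coeff k = 0 := by
  have h := congrArg (fun f : R[X] => f.coeff k) hp
  simp only [coeff_comp_negX, hk.neg_one_pow, one_mul, coeff_neg] at h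
  have h' : (2 : R) * p.coeff k = 0 := by linear_combination h
  rcases mul_eq_zero.mp h' with h'' | h''
  · exact absurd h'' h2
  · exact h''

end Parity

section Cubic

variable {K : Type*} [Field K] [CharZero K]

/-- The cubic step of the proof of Theorem 4.4: if `q_3` of degree 3 commutes with `q_2 = x² + c`,
i.e. `q_3(x² + c) = q_3²(x) + c` (4.8), then "`q_3²(−x) = q_3²(x)`, and since `q_3` is of degree 3 we
see that `q_3(−x) = −q_3(x)`", `q_3(x) = b_1 x + b_3 x^3` (4.9) with "`b_3 = 1`, `b_1 = (3/2) c`,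
`c (c + 2) = 0`" — "Therefore the only possible values of c are −2 and 0."
(Over a field of characteristic zero.)
[cite: Rivlin1974, Sect. 4.1 Thm. 4.4 (proof, (4.8)-(4.9))] -/
theorem cubic_comm_X_sq_add_C (c : K) {q : K[X]}
    (hq : q.comp (X ^ 2 + Polynomial.C c) = (X ^ 2 + Polynomial.C c).comp q) (h3 : q.natDegree = 3) :
    (c = 0 ∨ c = -2) ∧ q = X ^ 3 + Polynomial.C (3 * c / 2) * X := by
  have hq0 : q ≠ 0 := by rintro rfl; simp at h3
  -- (4.8)
  have h48 : q.comp (X ^ 2 + Polynomial.C c) = q ^ 2 + Polynomial.C c := by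
    rw [hq]; simp only [add_comp, X_pow_comp, C_comp]
  -- replace `x` by `-x`: `q(-x)² = q(x)²`
  have hs_even : (X ^ 2 + Polynomial.C c : K[X]).comp (-X) = X ^ 2 + Polynomial.C c := by
    simp only [add_comp, X_pow_comp, C_comp, neg_sq]
  have hsq : (q.comp (-X)) ^ 2 = q ^ 2 := by
    have h := congrArg (fun f : K[X] => f.comp (-X)) h48
    simp only [comp_assoc, hs_even, add_comp, pow_comp, C_comp] at h
    rw [h48] at h
    linear_combination -h
  have hpm : (q.comp (-X) - q) * (q.comp (-X) + q) = 0 := by linear_combination hsq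
  have hb3 : q.coeff 3 ≠ 0 := by
    have h := leadingCoeff_ne_zero.mpr hq0
    rwa [leadingCoeff, h3] at h
  rcases mul_eq_zero.mp hpm with h | h
  · -- `q(-x) = q(x)` is impossible in degree 3
    exfalso
    have hr : q.comp (-X) = q := sub_eq_zero.mp h
    have hl := comp_neg_X_leadingCoeff_eq q
    rw [hr, h3] at hl
    have h' : (2 : K) * q.leadingCoeff = 0 := by linear_combination hl
    rcases mul_eq_zero.mp h' with h'' | h''
    · exact two_ne_zero h''
    · exact hq0 (leadingCoeff_eq_zero.mp h'')
  · -- `q` is odd: `q = b₁ x + b₃ x³`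
    have hr : q.comp (-X) = -q := eq_neg_of_add_eq_zero_left h
    have hc0 : q.coeff 0 = 0 := coeff_eq_zero_of_comp_neg_X_eq_neg two_ne_zero hr ⟨0, rfl⟩
    have hc2 : q.coeff 2 = 0 := coeff_eq_zero_of_comp_neg_X_eq_neg two_ne_zero hr ⟨1, rfl⟩
    obtain ⟨b₁, hb₁⟩ : ∃ b : K, b = q.coeff 1 := ⟨_, rfl⟩
    obtain ⟨b₃, hb₃⟩ : ∃ b : K, b = q.coeff 3 := ⟨_, rfl⟩
    rw [← hb₃] at hb3
    have hq4 : q = Polynomial.C b₁ * X + Polynomial.C b₃ * X ^ 3 := by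
      have h := as_sum_range_C_mul_X_pow q
      rw [h3] at h
      simp only [Finset.sum_range_succ, Finset.sum_range_zero, zero_add, hc0, hc2, map_zero, zero_mul,
        add_zero, pow_zero, mul_one, pow_one, ← hb₁, ← hb₃] at h
      exact h
    clear hb₁ hb₃
    subst hq4
    -- substitute (4.9) into (4.8) and equate coefficients of like powers
    have hE : Polynomial.C (b₃ - b₃ ^ 2) * X ^ 6 + Polynomial.C (3 * b₃ * c - 2 * b₁ * b₃) * X ^ 4
        + Polynomial.C (b₁ + 3 * b₃ * c ^ 2 - b₁ ^ 2) * X ^ 2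
        + Polynomial.C (b₁ * c + b₃ * c ^ 3 - c) = (0 : K[X]) := by
      have h := h48
      simp only [add_comp, mul_comp, C_comp, X_comp, X_pow_comp] at h
      simp only [map_sub, map_add, map_mul, map_pow, map_ofNat]
      linear_combination h
    have e6 : b₃ - b₃ ^ 2 = 0 := by
      have h := congrArg (fun f : K[X] => f.coeff 6) hE
      simp only [coeff_add, coeff_C_mul_X_pow, coeff_C, coeff_zero] at h
      norm_num at h
      linear_combination h
    have e4 : 3 * b₃ * c - 2 * b₁ * b₃ = 0 := by
      have h := congrArg (fun f : K[X] => f.coeff 4) hE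
      simp only [coeff_add, coeff_C_mul_X_pow, coeff_C, coeff_zero] at h
      norm_num at h
      linear_combination h
    have e2 : b₁ + 3 * b₃ * c ^ 2 - b₁ ^ 2 = 0 := by
      have h := congrArg (fun f : K[X] => f.coeff 2) hE
      simp only [coeff_add, coeff_C_mul_X_pow, coeff_C, coeff_zero] at h
      norm_num at h
      linear_combination h
    have hb3' : b₃ = 1 := by
      have h' : b₃ * (1 - b₃) = 0 := by linear_combination e6
      rcases mul_eq_zero.mp h' with h'' | h''
      · exact absurd h'' hb3
      · linear_combination -h''
    subst hb3'
    have hb1 : b₁ = 3 * c / 2 := by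
      field_simp
      linear_combination -e4
    subst hb1
    have hc : 3 * c * (c + 2) = 0 := by linear_combination 4 * e2
    refine ⟨?_, by rw [Polynomial.C_1, one_mul, add_comm]⟩
    rcases mul_eq_zero.mp hc with h' | h'
    · left
      rcases mul_eq_zero.mp h' with h'' | h''
      · norm_num at h''
      · exact h''
    · right
      linear_combination h'

end Cubic

section Dickson

variable {R : Type*} [CommRing R]

/-- Mathlib's `Chebyshev.C n` (`C_n(x) = 2 T_n(x/2)`: `C_1 = x`, `C_2 = x² − 2`, `C_3 = x³ − 3x`, …,
`Polynomial.Chebyshev.C_comp_two_mul_X`) is monic of degree `n` for `n ≥ 1`; these are the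
polynomials `q_2 = x² − 2`, `q_3 = x³ − 3x` reached in the proof of Theorem 4.4 (case `c = −2`).
[cite: Rivlin1974, Sect. 4.1 Thm. 4.4 (proof, case c = -2); Ex. 1.5.31 (b)] -/
theorem monic_chebyshevC_and_natDegree [Nontrivial R] :
    ∀ n : ℕ, (Chebyshev.C R (n + 1 : ℕ)).Monic ∧ (Chebyshev.C R (n + 1 : ℕ)).natDegree = n + 1
  | 0 => by simp [monic_X]
  | 1 => by
      have h : Chebyshev.C R ((1 + 1 : ℕ) : ℤ) = X ^ 2 - Polynomial.C 2 := by
        rw [show ((1 + 1 : ℕ) : ℤ) = 2 by norm_num, Chebyshev.C_two, map_ofNat]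
      rw [h]
      exact ⟨monic_X_pow_sub_C _ two_ne_zero, natDegree_X_pow_sub_C⟩
  | n + 2 => by
      obtain ⟨hm₁, hd₁⟩ := monic_chebyshevC_and_natDegree (n + 1)
      obtain ⟨-, hd₀⟩ := monic_chebyshevC_and_natDegree n
      have hrec : Chebyshev.C R ((n + 2 + 1 : ℕ) : ℤ)
          = X * Chebyshev.C R ((n + 1 + 1 : ℕ) : ℤ) - Chebyshev.C R ((n + 1 : ℕ) : ℤ) := by
        have h := Chebyshev.C_add_two R ((n + 1 : ℕ) : ℤ)
        rw [show ((n + 1 : ℕ) : ℤ) + 2 = ((n + 2 + 1 : ℕ) : ℤ) by push_cast; ring,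
          show ((n + 1 : ℕ) : ℤ) + 1 = ((n + 1 + 1 : ℕ) : ℤ) by push_cast; ring] at h
        exact h
      have hne : Chebyshev.C R ((n + 1 + 1 : ℕ) : ℤ) ≠ 0 := hm₁.ne_zero
      have hdX : (X * Chebyshev.C R ((n + 1 + 1 : ℕ) : ℤ)).natDegree = n + 2 + 1 := by
        rw [natDegree_X_mul hne, hd₁]
      have hlt : (Chebyshev.C R ((n + 1 : ℕ) : ℤ)).natDegree
          < (X * Chebyshev.C R ((n + 1 + 1 : ℕ) : ℤ)).natDegree := by
        rw [hdX, hd₀]; omega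
      rw [hrec]
      refine ⟨(monic_X.mul hm₁).sub_of_left (degree_lt_degree hlt), ?_⟩
      rw [natDegree_sub_eq_left_of_natDegree_lt hlt, hdX]

/-- `natDegree C_n = n` (`n ≥ 1`, nontrivial ring). [cite: Rivlin1974, Sect. 4.1 Thm. 4.4 (proof, case c = -2)] -/
theorem natDegree_chebyshevC [Nontrivial R] (n : ℕ) :
    (Chebyshev.C R (n + 1 : ℕ)).natDegree = n + 1 :=
  (monic_chebyshevC_and_natDegree n).2

open Literature.Algebra.Polynomial.ChebyshevBertram in
/-- The third normal form of a chain: `{C_{j}}` (`x, x² − 2, x³ − 3x, …`) is a chain — Mathlib's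
`Polynomial.Chebyshev.C_mul : C (m n) = (C m) ∘ (C n)`; it is similar to `{T_j}` through `x ↦ 2x`
(`Polynomial.Chebyshev.C_comp_two_mul_X`). [cite: Rivlin1974, Sect. 4.1 Thm. 4.4 (proof, case c = -2), (4.3)] -/
theorem isPermutableChain_chebyshevC [Nontrivial R] :
    IsPermutableChain (fun j => Chebyshev.C R (j + 1 : ℕ)) := by
  refine ⟨fun j => natDegree_chebyshevC j, fun i j => ?_⟩
  show (Chebyshev.C R (i + 1 : ℕ)).comp (Chebyshev.C R (j + 1 : ℕ))
    = (Chebyshev.C R (j + 1 : ℕ)).comp (Chebyshev.C R (i + 1 : ℕ))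
  rw [← Chebyshev.C_mul, ← Chebyshev.C_mul, mul_comm]

end Dickson


section Chains

open Literature.Algebra.Polynomial.ChebyshevBertram

variable {K : Type*} [Field K]

/-- Chains are carried to chains by similarity: if `λ ∘ μ = x` with `λ, μ` of degree one, then
`{μ ∘ p_j ∘ λ}` (Rivlin's `λ⁻¹ · p_j · λ`, (4.3)) is again a chain.
[cite: Rivlin1974, Sect. 4.1 (4.3), chains (pp. 99-100)] -/
theorem isPermutableChain_similar {p : ℕ → K[X]} (hp : IsPermutableChain p) {lam mu : K[X]}
    (h : lam.comp mu = X) (hl : lam.natDegree = 1) (hm : mu.natDegree = 1) :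
    IsPermutableChain (fun j => mu.comp ((p j).comp lam)) := by
  refine ⟨fun j => ?_, fun i j => similar_comm_of_comm h (hp.2 i j)⟩
  show (mu.comp ((p j).comp lam)).natDegree = j + 1
  rw [natDegree_comp, natDegree_comp, hp.1 j, hl, hm, mul_one, one_mul]

/-- The similarity `μ(x) = 2x` of the last step of the proof of Theorem 4.4. [folklore] -/
private theorem two_mul_X_comp_half_X (h2 : (2 : K) ≠ 0) :
    (2 * X : K[X]).comp (Polynomial.C 2⁻¹ * X) = X := by
  rw [← map_ofNat Polynomial.C 2, mul_comp, C_comp, X_comp, ← mul_assoc, ← map_mul,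
    mul_inv_cancel₀ h2, map_one, one_mul]

/-- `2 · (q/2) = q`, composition form. [folklore] -/
private theorem two_mul_half_X_comp (h2 : (2 : K) ≠ 0) (q : K[X]) :
    2 * (Polynomial.C 2⁻¹ * X : K[X]).comp q = q := by
  rw [mul_comp, C_comp, X_comp, ← mul_assoc, ← map_ofNat Polynomial.C 2, ← map_mul,
    mul_inv_cancel₀ h2, map_one, one_mul]

/-- `(2q)/2 = q`, composition form. [folklore] -/
private theorem half_X_comp_two_mul (h2 : (2 : K) ≠ 0) (q : K[X]) :
    (Polynomial.C 2⁻¹ * X : K[X]).comp (2 * q) = q := by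
  rw [mul_comp, C_comp, X_comp, ← mul_assoc, ← map_ofNat Polynomial.C 2, ← map_mul,
    inv_mul_cancel₀ h2, map_one, one_mul]

/-- `deg (2x) = 1` when `2 ≠ 0`. [folklore] -/
private theorem natDegree_two_mul_X (h2 : (2 : K) ≠ 0) : (2 * X : K[X]).natDegree = 1 := by
  rw [← map_ofNat Polynomial.C 2, natDegree_C_mul h2, natDegree_X]

/-- `deg (x/2) = 1` when `2 ≠ 0`. [folklore] -/
private theorem natDegree_half_X (h2 : (2 : K) ≠ 0) :
    (Polynomial.C 2⁻¹ * X : K[X]).natDegree = 1 := by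
  rw [natDegree_C_mul (inv_ne_zero h2), natDegree_X]

variable [CharZero K]

/-- A chain containing `x² − 2` is `{C_j}` (`C_1 = x, C_2 = x² − 2, C_3 = x³ − 3x, …`): the case
`c = −2` of the proof of Theorem 4.4, reduced to Theorem 4.1 by the similarity `μ(x) = 2x`
(`C_n(2x) = 2 T_n(x)`, Mathlib `Polynomial.Chebyshev.C_comp_two_mul_X`).
[cite: Rivlin1974, Sect. 4.1 Thm. 4.4 (proof, case c = -2); Thm. 4.1] -/
theorem isPermutableChain_apply_eq_chebyshevC {p : ℕ → K[X]} (hp : IsPermutableChain p)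
    (h2 : p 1 = X ^ 2 - 2) (j : ℕ) : p j = Chebyshev.C K (j + 1 : ℕ) := by
  have h2K : (2 : K) ≠ 0 := two_ne_zero
  have hlm := two_mul_X_comp_half_X h2K
  have hq := isPermutableChain_similar hp hlm (natDegree_two_mul_X h2K) (natDegree_half_X h2K)
  have hq1 : (fun j => (Polynomial.C 2⁻¹ * X : K[X]).comp ((p j).comp (2 * X))) 1 = T K 2 := by
    show (Polynomial.C 2⁻¹ * X : K[X]).comp ((p 1).comp (2 * X)) = T K 2
    rw [h2, ← Chebyshev.C_two, Chebyshev.C_comp_two_mul_X, half_X_comp_two_mul h2K]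
  have hj : (Polynomial.C 2⁻¹ * X : K[X]).comp ((p j).comp (2 * X)) = T K (j + 1 : ℕ) :=
    hq.apply_eq_T hq1 j
  -- undo the similarity: `p_j(2x) = 2 T_{j+1}(x) = C_{j+1}(2x)`, then substitute `x/2`
  have hA : (p j).comp (2 * X) = (Chebyshev.C K (j + 1 : ℕ)).comp (2 * X) := by
    rw [Chebyshev.C_comp_two_mul_X, ← hj, two_mul_half_X_comp h2K]
  have hB := congrArg (fun f : K[X] => f.comp (Polynomial.C 2⁻¹ * X)) hA
  simp only [comp_assoc, hlm, comp_X] at hB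
  exact hB

/-- THEOREM 4.4 (Block and Thielman [1], Jacobsthal [1]): "Every chain is either similar to `{x^j}`,
`j = 1, 2, …`, or `{T_j}`, `j = 1, 2, …`" — over any field of characteristic zero, by Rivlin's proof:
conjugate the quadratic member to `x² + c` by (4.5); the cubic member forces `c ∈ {0, −2}`
((4.8)-(4.9)); `c = 0` gives `{x^j}` by Theorem 4.2, and `c = −2` gives `{C_j}`, similar to `{T_j}`
through `μ(x) = 2x`, by Theorem 4.1.  The similarity is recorded as a pair `λ, μ` of degree-one
polynomials with `λ ∘ μ = μ ∘ λ = x`, the conjugate of `p_j` being `μ ∘ p_j ∘ λ = λ⁻¹ · p_j · λ`.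
[cite: Rivlin1974, Sect. 4.1 Thm. 4.4, (4.3), (4.5), (4.8)-(4.9); Block-Thielman, Quart. J. Math. Oxford (2) 2 (1951) 241-243; Jacobsthal, Math. Z. 63 (1955) 243-276] -/
theorem isPermutableChain_similar_X_pow_or_T {p : ℕ → K[X]} (hp : IsPermutableChain p) :
    ∃ lam mu : K[X], lam.natDegree = 1 ∧ mu.natDegree = 1 ∧ lam.comp mu = X ∧ mu.comp lam = X ∧
      ((∀ j, mu.comp ((p j).comp lam) = X ^ (j + 1)) ∨
        (∀ j, mu.comp ((p j).comp lam) = T K (j + 1 : ℕ))) := by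
  -- the quadratic member `p₂ = a₀ + a₁ x + a₂ x²`
  have h2 : (p 1).natDegree = 2 := hp.1 1
  have hp10 : p 1 ≠ 0 := by intro h; rw [h, natDegree_zero] at h2; exact absurd h2 (by norm_num)
  obtain ⟨a₀, ha₀⟩ : ∃ a : K, a = (p 1).coeff 0 := ⟨_, rfl⟩
  obtain ⟨a₁, ha₁⟩ : ∃ a : K, a = (p 1).coeff 1 := ⟨_, rfl⟩
  obtain ⟨a₂, ha₂⟩ : ∃ a : K, a = (p 1).coeff 2 := ⟨_, rfl⟩
  have ha2 : a₂ ≠ 0 := by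
    have h := leadingCoeff_ne_zero.mpr hp10
    rwa [leadingCoeff, h2, ← ha₂] at h
  have hp1 : p 1 = Polynomial.C a₀ + Polynomial.C a₁ * X + Polynomial.C a₂ * X ^ 2 := by
    have h := as_sum_range_C_mul_X_pow (p 1)
    rw [h2] at h
    simp only [Finset.sum_range_succ, Finset.sum_range_zero, zero_add, pow_zero, mul_one, pow_one,
      ← ha₀, ← ha₁, ← ha₂] at h
    exact h
  -- (4.5): `λ₁⁻¹ · p₂ · λ₁ = x² + c`
  obtain ⟨lam₁, hlam₁⟩ : ∃ l : K[X], l = Polynomial.C a₂⁻¹ * (X - Polynomial.C (a₁ / 2)) := ⟨_, rfl⟩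
  obtain ⟨mu₁, hmu₁⟩ : ∃ m : K[X], m = Polynomial.C a₂ * X + Polynomial.C (a₁ / 2) := ⟨_, rfl⟩
  obtain ⟨c, hc⟩ : ∃ c : K, c = a₀ * a₂ + a₁ / 2 - (a₁ / 2) ^ 2 := ⟨_, rfl⟩
  have hlm₁ : lam₁.comp mu₁ = X := by rw [hlam₁, hmu₁]; exact affineInv_comp_affine a₂ (a₁ / 2) ha2
  have hml₁ : mu₁.comp lam₁ = X := by rw [hlam₁, hmu₁]; exact affine_comp_affineInv a₂ (a₁ / 2) ha2
  have hl₁ : lam₁.natDegree = 1 := by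
    rw [hlam₁, natDegree_C_mul (inv_ne_zero ha2), natDegree_X_sub_C]
  have hm₁ : mu₁.natDegree = 1 := by rw [hmu₁, natDegree_linear ha2]
  have hq : IsPermutableChain (fun j => mu₁.comp ((p j).comp lam₁)) :=
    isPermutableChain_similar hp hlm₁ hl₁ hm₁
  have hq1 : mu₁.comp ((p 1).comp lam₁) = X ^ 2 + Polynomial.C c := by
    rw [hp1, hmu₁, hlam₁, hc]
    exact quadratic_conj_eq_X_sq_add_C a₀ a₁ a₂ ha2
  -- the cubic member forces `c = 0` or `c = -2`
  have hcomm : (mu₁.comp ((p 2).comp lam₁)).comp (X ^ 2 + Polynomial.C c)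
      = (X ^ 2 + Polynomial.C c).comp (mu₁.comp ((p 2).comp lam₁)) := by
    rw [← hq1]
    exact hq.2 2 1
  obtain ⟨hc0 | hc2, -⟩ := cubic_comm_X_sq_add_C c hcomm (hq.1 2)
  · -- `c = 0`: the chain through `x²` is `{x^j}` (Theorem 4.2)
    refine ⟨lam₁, mu₁, hl₁, hm₁, hlm₁, hml₁, Or.inl fun j => ?_⟩
    have hq1' : (fun j => mu₁.comp ((p j).comp lam₁)) 1 = X ^ 2 := by
      show mu₁.comp ((p 1).comp lam₁) = X ^ 2
      rw [hq1, hc0, map_zero, add_zero]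
    exact hq.apply_eq_X_pow hq1' j
  · -- `c = -2`: the chain through `x² - 2` is `{C_j}`, similar to `{T_j}` through `μ(x) = 2x`
    have h2K : (2 : K) ≠ 0 := two_ne_zero
    have hq1' : (fun j => mu₁.comp ((p j).comp lam₁)) 1 = X ^ 2 - 2 := by
      show mu₁.comp ((p 1).comp lam₁) = X ^ 2 - 2
      rw [hq1, hc2, map_neg, map_ofNat, sub_eq_add_neg]
    have hqj : ∀ j, mu₁.comp ((p j).comp lam₁) = Chebyshev.C K (j + 1 : ℕ) :=
      fun j => isPermutableChain_apply_eq_chebyshevC hq hq1' j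
    have hlm₂ := two_mul_X_comp_half_X h2K
    have hml₂ : (Polynomial.C 2⁻¹ * X : K[X]).comp (2 * X) = X := half_X_comp_two_mul h2K X
    have hall : ∀ j, ((Polynomial.C 2⁻¹ * X : K[X]).comp mu₁).comp ((p j).comp (lam₁.comp (2 * X)))
        = T K (j + 1 : ℕ) := by
      intro j
      rw [comp_assoc, ← comp_assoc (p j) lam₁, ← comp_assoc mu₁, hqj j, Chebyshev.C_comp_two_mul_X,
        half_X_comp_two_mul h2K]
    refine ⟨lam₁.comp (2 * X), (Polynomial.C 2⁻¹ * X : K[X]).comp mu₁, ?_, ?_, ?_, ?_, Or.inr hall⟩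
    · rw [natDegree_comp, hl₁, natDegree_two_mul_X h2K]
    · rw [natDegree_comp, natDegree_half_X h2K, hm₁]
    · rw [comp_assoc, ← comp_assoc (2 * X : K[X]), hlm₂, X_comp, hlm₁]
    · rw [comp_assoc, ← comp_assoc mu₁, hml₁, X_comp, hml₂]

end Chains

end Literature.Algebra.Polynomial.ChebyshevChains
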